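import Summits.Ventures.HodgeRepro2.T5InertWeylCells
import Summits.Ventures.HodgeRepro2.T5InertUnipotentResidue

/-!
# The first step of the tower: `[K : K_{1,1}] = #𝔽 · #{trace zero} + 1`
(cell pub-hodge-repro2, seat p3)

Tier-5 N3 support, towards the count `deg Tₙ = (q³ + 1) q^{4n−3}` of T5-SATAKE-KERNEL-p3.md row 11
(continuation of files 195–199). The coset space `K / K_{1,1}` — the isotropic lines of the residue hermitian
form — is the disjoint union of the big cell `N_{0,0}/N_{1,1}` and the point `w K_{1,1}` (file 199):

* **`relIndex_congSubgroup_one_one_eq_add_one`** — `[K : K_{1,1}] = [N_{0,0} : N_{1,1}] + 1` (an explicit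
  bijection `N_{0,0}/N_{1,1} ⊕ Unit ≃ K/K_{1,1}`; the unipotent index assumed finite);
* `relIndex_unipCong_one_one` — `[N_{0,0} : N_{1,1}] = #𝔽 · #{t ∈ 𝔽 : t + t̄ = 0}` through
  `N_{0,0} ⊃ N_{1,0} ⊃ N_{1,1}` (file 196);
* **`relIndex_congSubgroup_one_one`** — `[K : K_{1,1}] = #𝔽 · #{t ∈ 𝔽 : t + t̄ = 0} + 1` (for a finite residue
  field; with `#𝔽 = q²` and `#{trace zero} = q` this is the count `q³ + 1` of isotropic lines).

Mathlib + this seat's files 196 / 199 and their imports; no display; no device.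
§8(d): uses an L-value-free non-vanishing device: NO.
-/

namespace Summit.Ventures.HodgeRepro2.T5InertIsotropicLines

open Matrix
open Summit.Ventures.HodgeRepro2.T5CartanCellsDistinct Summit.Ventures.HodgeRepro2.T5HermitianThreeElements
  Summit.Ventures.HodgeRepro2.T5UnitaryGroupForm Summit.Ventures.HodgeRepro2.T5UnitaryThreeCorner
  Summit.Ventures.HodgeRepro2.T5UnitaryHeckeAdjoint Summit.Ventures.HodgeRepro2.T5InertUnipotentCongruence
  Summit.Ventures.HodgeRepro2.T5InertCongruenceSubgroups Summit.Ventures.HodgeRepro2.T5InertIwahoriFactorisation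
  Summit.Ventures.HodgeRepro2.T5InertUnipotentResidue Summit.Ventures.HodgeRepro2.T5InertWeylCells

section Lines

variable {R E : Type*} [CommRing R] [IsDomain R] [IsDiscreteValuationRing R] [Field E] [StarRing E]
  [Algebra R E] [IsFractionRing R E]
  (hstar : ∀ x : E, IsLocalization.IsInteger R x → IsLocalization.IsInteger R (star x))
  (u : E) (hsu : star u = u) (hu0 : u ≠ 0) (hu : IsLocalization.IsInteger R u)
  (hu' : IsLocalization.IsInteger R u⁻¹)
  {ϖ : R} (hϖ : Irreducible ϖ) (hs : star (algebraMap R E ϖ) = algebraMap R E ϖ)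

/-! ### The coset space `K / K_{1,1} = N_{0,0}/N_{1,1} ⊔ {w K_{1,1}}` and its cardinality -/

include hstar hsu hu0 hu hu' hϖ hs in
/-- **`[K : K_{1,1}] = [N_{0,0} : N_{1,1}] + 1`** (given that the unipotent index is finite). -/
theorem relIndex_congSubgroup_one_one_eq_add_one
    [Finite (unipCong hstar u hu' hs 0 0 le_rfl ⧸
      (unipCong hstar u hu' hs 1 1 one_le_two).subgroupOf (unipCong hstar u hu' hs 0 0 le_rfl))] :
    (congSubgroup hstar u hu0 hu hu' hϖ hs 1 1 le_rfl one_le_two).relIndex (hyperspecialSubgroup R (J3 u)) =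
      (unipCong hstar u hu' hs 1 1 one_le_two).relIndex (unipCong hstar u hu' hs 0 0 le_rfl) + 1 := by
  set K₁₁ := congSubgroup hstar u hu0 hu hu' hϖ hs 1 1 le_rfl one_le_two with hK₁₁
  set N₀₀ := unipCong hstar u hu' hs 0 0 le_rfl with hN₀₀
  set N₁₁ := unipCong hstar u hu' hs 1 1 one_le_two with hN₁₁
  have hN : N₀₀ ≤ hyperspecialSubgroup R (J3 u) :=
    (unipCong_le_congSubgroup hstar u hu0 hu hu' hϖ hs (a := 0) (b := 0) (hab := le_rfl)
      (hba := le_rfl)).trans (by rw [congSubgroup_zero_zero])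
  have hsub : K₁₁.subgroupOf N₀₀ = N₁₁.subgroupOf N₀₀ := by
    ext ν
    rw [Subgroup.mem_subgroupOf, Subgroup.mem_subgroupOf]
    constructor
    · intro h
      have : (ν : formUnitaryGroup (J3 u)) ∈ N₀₀ ⊓ K₁₁ := ⟨ν.2, h⟩
      exact (unipCong_inf_congSubgroup hstar u hu0 hu hu' hϖ hs (hab' := le_rfl) (hba' := one_le_two)
        (Nat.zero_le 1) (Nat.zero_le 1)).le this
    · intro h
      exact unipCong_le_congSubgroup hstar u hu0 hu hu' hϖ hs h
  unfold Subgroup.relIndex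
  rw [Subgroup.index_eq_card, Subgroup.index_eq_card, ← hsub]
  haveI : Finite (N₀₀ ⧸ K₁₁.subgroupOf N₀₀) := by rw [hsub]; infer_instance
  have e : (N₀₀ ⧸ K₁₁.subgroupOf N₀₀) ⊕ Unit ≃
      hyperspecialSubgroup R (J3 u) ⧸ K₁₁.subgroupOf (hyperspecialSubgroup R (J3 u)) :=
    Equiv.ofBijective ?_ ⟨?_, ?_⟩
  · rw [← Nat.card_congr e, Nat.card_sum, Nat.card_unique (α := Unit)]
  · exact fun x => Sum.elim (Quotient.map' (fun ν : N₀₀ => (⟨ν, hN ν.2⟩ : hyperspecialSubgroup R (J3 u)))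
      (fun ν₁ ν₂ h => by
        have h' := QuotientGroup.leftRel_apply.1 h
        refine QuotientGroup.leftRel_apply.2 ?_
        simpa only [Subgroup.mem_subgroupOf, Subgroup.coe_mul, Subgroup.coe_inv] using h'))
      (fun _ => ((⟨weylG u, weylG_mem_hyperspecial u⟩ : hyperspecialSubgroup R (J3 u)) :
        hyperspecialSubgroup R (J3 u) ⧸ K₁₁.subgroupOf (hyperspecialSubgroup R (J3 u)))) x
  · rintro (x | ⟨⟩) (y | ⟨⟩)
    · induction x using QuotientGroup.induction_on with
      | H ν₁ =>
      induction y using QuotientGroup.induction_on with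
      | H ν₂ =>
      intro hxy
      have hxy' : ((⟨ν₁, hN ν₁.2⟩ : hyperspecialSubgroup R (J3 u)) :
          hyperspecialSubgroup R (J3 u) ⧸ K₁₁.subgroupOf (hyperspecialSubgroup R (J3 u))) =
          ((⟨ν₂, hN ν₂.2⟩ : hyperspecialSubgroup R (J3 u)) :
          hyperspecialSubgroup R (J3 u) ⧸ K₁₁.subgroupOf (hyperspecialSubgroup R (J3 u))) := hxy
      rw [QuotientGroup.eq] at hxy'
      congr 1
      rw [QuotientGroup.eq]
      simpa only [Subgroup.mem_subgroupOf, Subgroup.coe_mul, Subgroup.coe_inv] using hxy'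
    · induction x using QuotientGroup.induction_on with
      | H ν =>
      intro hxy
      exfalso
      have hxy' : ((⟨ν, hN ν.2⟩ : hyperspecialSubgroup R (J3 u)) :
          hyperspecialSubgroup R (J3 u) ⧸ K₁₁.subgroupOf (hyperspecialSubgroup R (J3 u))) =
          ((⟨weylG u, weylG_mem_hyperspecial u⟩ : hyperspecialSubgroup R (J3 u)) :
          hyperspecialSubgroup R (J3 u) ⧸ K₁₁.subgroupOf (hyperspecialSubgroup R (J3 u))) := hxy
      rw [QuotientGroup.eq, Subgroup.mem_subgroupOf] at hxy'
      -- `w = ν λ` with `λ ∈ K₁₁`, so `w₂₂` is a unit; but `w₂₂ = 0`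
      have hw : weylG u = (ν : formUnitaryGroup (J3 u)) * ((ν : formUnitaryGroup (J3 u))⁻¹ * weylG u) := by
        rw [← mul_assoc, mul_inv_cancel, one_mul]
      have hunit := entry_two_two_isUnit_of_mem_unipCong_mul hstar u hu0 hu hu' hϖ hs ν.2
        (by simpa only [Subgroup.coe_mul, Subgroup.coe_inv] using hxy')
      rw [← hw, weylG_entry_two_two] at hunit
      exact hunit.2 rfl
    · induction y using QuotientGroup.induction_on with
      | H ν =>
      intro hxy
      exfalso
      have hxy' : ((⟨weylG u, weylG_mem_hyperspecial u⟩ : hyperspecialSubgroup R (J3 u)) :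
          hyperspecialSubgroup R (J3 u) ⧸ K₁₁.subgroupOf (hyperspecialSubgroup R (J3 u))) =
          ((⟨ν, hN ν.2⟩ : hyperspecialSubgroup R (J3 u)) :
          hyperspecialSubgroup R (J3 u) ⧸ K₁₁.subgroupOf (hyperspecialSubgroup R (J3 u))) := hxy
      rw [eq_comm, QuotientGroup.eq, Subgroup.mem_subgroupOf] at hxy'
      have hw : weylG u = (ν : formUnitaryGroup (J3 u)) * ((ν : formUnitaryGroup (J3 u))⁻¹ * weylG u) := by
        rw [← mul_assoc, mul_inv_cancel, one_mul]
      have hunit := entry_two_two_isUnit_of_mem_unipCong_mul hstar u hu0 hu hu' hϖ hs ν.2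
        (by simpa only [Subgroup.coe_mul, Subgroup.coe_inv] using hxy')
      rw [← hw, weylG_entry_two_two] at hunit
      exact hunit.2 rfl
    · intro _
      rfl
  · intro y
    induction y using QuotientGroup.induction_on with
    | H κ =>
    have hκi := isInteger_apply_of_mem_range
      ((mem_hyperspecialSubgroup_iff R (κ : formUnitaryGroup (J3 u))).1 κ.2)
    rcases isInteger_inv_or_isInteger_mul_inv hϖ (hκi 2 2) with ⟨hr0, hrinv⟩ | hr
    · obtain ⟨ν, hν, hmem⟩ := exists_unipCong_inv_mul_mem_of_isUnit hstar u hsu hu0 hu hu' hϖ hs κ.2 hrinv hr0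
      refine ⟨Sum.inl (((⟨ν, hν⟩ : N₀₀) : N₀₀ ⧸ K₁₁.subgroupOf N₀₀)), ?_⟩
      change ((⟨ν, hN hν⟩ : hyperspecialSubgroup R (J3 u)) :
        hyperspecialSubgroup R (J3 u) ⧸ K₁₁.subgroupOf (hyperspecialSubgroup R (J3 u))) = (κ : _)
      rw [QuotientGroup.eq, Subgroup.mem_subgroupOf]
      simpa only [Subgroup.coe_mul, Subgroup.coe_inv] using hmem
    · refine ⟨Sum.inr (), ?_⟩
      change ((⟨weylG u, weylG_mem_hyperspecial u⟩ : hyperspecialSubgroup R (J3 u)) :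
        hyperspecialSubgroup R (J3 u) ⧸ K₁₁.subgroupOf (hyperspecialSubgroup R (J3 u))) = (κ : _)
      rw [QuotientGroup.eq, Subgroup.mem_subgroupOf]
      have := weylG_mul_mem_congSubgroup_of_not_isUnit hstar u hu0 hu hu' hϖ hs κ.2 hr
      simpa only [Subgroup.coe_mul, Subgroup.coe_inv, weylG_inv] using this

include hstar hsu hu0 hu' hϖ hs in
/-- **`[N_{0,0} : N_{1,1}] = #𝔽 · #{t ∈ 𝔽 : t + t̄ = 0}`** through `N_{0,0} ⊃ N_{1,0} ⊃ N_{1,1}`. -/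
theorem relIndex_unipCong_one_one (htr : ∃ e : R, algebraMap R E e + star (algebraMap R E e) = 1) :
    (unipCong hstar u hu' hs 1 1 one_le_two).relIndex (unipCong hstar u hu' hs 0 0 le_rfl) =
      Nat.card (IsLocalRing.ResidueField R) * Nat.card (traceZero R E) := by
  have h1 : unipCong hstar u hu' hs 1 1 one_le_two ≤ unipCong hstar u hu' hs 1 0 (Nat.zero_le 2) := by
    rintro g ⟨x, z, hg⟩
    exact ⟨x, ϖ * z, by rw [hg]; simp only [map_mul, pow_zero, pow_one, one_mul]⟩
  have h2 : unipCong hstar u hu' hs 1 0 (Nat.zero_le 2) ≤ unipCong hstar u hu' hs 0 0 le_rfl := by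
    rintro g ⟨x, z, hg⟩
    exact ⟨ϖ * x, z, by rw [hg]; simp only [map_mul, pow_zero, pow_one, one_mul]⟩
  rw [← Subgroup.relIndex_mul_relIndex _ _ _ h1 h2,
    relIndex_unipCong_succ_right hstar u hsu hu0 hu' hϖ hs (a := 1) (b := 0) (hab := Nat.zero_le 2) htr
      one_le_two,
    relIndex_unipCong_succ_left hstar u hsu hu0 hu' hϖ hs (a := 0) (b := 0) (hab := le_rfl) htr
      (Nat.zero_le 2), mul_comm]

include hstar hsu hu0 hu hu' hϖ hs in
/-- **`[K : K_{1,1}] = #𝔽 · #{t ∈ 𝔽 : t + t̄ = 0} + 1`**: the number of isotropic lines of the residue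
hermitian form (for `#𝔽 = q²`, `#{trace zero} = q`: `q³ + 1`). -/
theorem relIndex_congSubgroup_one_one [Finite (IsLocalRing.ResidueField R)]
    (htr : ∃ e : R, algebraMap R E e + star (algebraMap R E e) = 1) :
    (congSubgroup hstar u hu0 hu hu' hϖ hs 1 1 le_rfl one_le_two).relIndex (hyperspecialSubgroup R (J3 u)) =
      Nat.card (IsLocalRing.ResidueField R) * Nat.card (traceZero R E) + 1 := by
  have hidx := relIndex_unipCong_one_one hstar u hsu hu0 hu' hϖ hs htr
  have hne : (unipCong hstar u hu' hs 1 1 one_le_two).relIndex (unipCong hstar u hu' hs 0 0 le_rfl) ≠ 0 := by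
    rw [hidx]
    refine mul_ne_zero (Nat.card_ne_zero.2 ⟨⟨0⟩, inferInstance⟩)
      (Nat.card_ne_zero.2 ⟨⟨⟨0, ⟨0, map_zero _, ?_⟩⟩⟩, inferInstance⟩)
    rw [map_zero, star_zero, add_zero]
  haveI : Finite (unipCong hstar u hu' hs 0 0 le_rfl ⧸
      (unipCong hstar u hu' hs 1 1 one_le_two).subgroupOf (unipCong hstar u hu' hs 0 0 le_rfl)) :=
    Nat.finite_of_card_ne_zero hne
  rw [relIndex_congSubgroup_one_one_eq_add_one hstar u hsu hu0 hu hu' hϖ hs, hidx]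

end Lines

end Summit.Ventures.HodgeRepro2.T5InertIsotropicLines
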